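import Mathlib
import HarnessLib
import Summits.MatrixMultiplication.MatrixMultiplication.Theorems.FarEdgeDescentDialStaircase

/-!
# Far-edge descent, kernel XLIV-B — the budget at the deep fixed point with narrowness (germ of the limit criterion)

Lens «structural dichotomy (special vs generic)», MODEL level; nothing here enters the route's cut
`closes`; rung currency 0.  A hand-written addendum to XLIII/XLIV: the pair inequality of the
region criterion evaluated EXACTLY at the symmetric deep fixed-point pair
`λ = λ' = 1/(2β−1)`, `V = V' = v`, `x = 1/2`, now with narrowness `v` (XLIII's `fixedPoint_gap` is
the case `v = 0`).

* `fixedPoint_VP` — the product's narrowness there is `V_P = (2(β−1)v + z v²)/(2β−1)`, and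
  `fixedPoint_VP_lt` — it is STRICTLY SMALLER than `v` whenever `0 < v` and `z v < 1`: at the deep
  fixed point, squaring CONTRACTS narrowness by the factor `(2(β−1) + z v)/(2β−1) < 1` (at `β = 2`:
  `(2 + z v)/3`).  Iterated squaring therefore drives narrowness below every positive floor; the
  criterion's hypothesis `Vmin ≤ V_P` is exactly what removes these pairs — the floor's whole role.
* `fixedPoint_budget` — the identity
  `RHS − LHS = (v(2 − β/2) − z v² − (ε+1)(2−β)/2)/(2β−1)²`
  for the pair inequality at that point (at `κ_S`, using `(1/2)^{κ_S} = 3/4`), and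
  `fixedPoint_pair_iff` — the pair inequality holds there iff `(ε+1)(2−β)/2 + z v² ≤ (2 − β/2)·v`.
  Reading: the deficit `(ε+1)(2−β)/2` is LINEAR in `2 − β` and is paid by narrowness `v` at rate
  `2 − β/2 → 1`; a pair sitting AT a floor of size `(2−β)/2` (the asymptotic size of `Vfloor`, XLIII
  `Vfloor_le_one_sub_half`) is marginal, but such a pair is excluded since its product is
  narrower than the floor (precisely: at `v = (2−β)/2` the first-order terms cancel and the
  inequality holds iff `2ε ≤ (1−z)(2−β)`, `fixedPoint_at_half_gap_iff`); the surviving pairs have `v ≥ v_min(β)` with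
  `2(β−1)v_min + z v_min² = (2β−1)·Vfloor`, i.e. `v_min ≈ (3/2)·Vfloor` near `β = 2`, and then the
  budget closes with a margin linear in `2 − β` (memo NODE-g63 §3: numerically `≈ 0.08·(2−β)`
  relative to `λ_P`, stable down to `2 − β ≈ 10⁻⁴` for the renormalised family
  `z = 1 − (2/3)(2−β)`, `ε = 1 − z`, depth `m = ⌈log₂(1/(2−β))⌉ + 4`).  This linear-in-`(2−β)`
  bookkeeping at the tight endpoint is the germ of the LIMIT CRITERION the lens proposes for the
  open corner `(199/100, 2)`.

HONEST FRAMING: exact algebraic identities / elementary inequalities in real variables; no `sorry`,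
no new definitions, no axioms; nothing about tensors or `ω`; the numerical constants quoted in
prose are memo data, not theorems.  References: kernels XLI (`FarEdgeDescentNarrownessPotential`,
the `RegionCriterion`), XLIII (`FarEdgeDescentDialDegeneration`), XLIV (`FarEdgeDescentDialStaircase`);
Schönhage 1981 [Schonhage1981].
-/

noncomputable section

set_option linter.dupNamespace false

namespace Summit.MatrixMultiplication.MatrixMultiplication.Theorems.FarEdgeDescentFixedPointBudget

open Summit.MatrixMultiplication.MatrixMultiplication.Theorems.FarEdgeDescentTreeCapTools

/-! ## Narrowness of the square at the deep fixed point -/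

/-- **`V_P` at the symmetric deep fixed-point pair.** With `λ = λ' = 1/(2β−1)` and `V = V' = v` the
exact product rule `V_P·λ_P = λ'(1−βλ)V' + λ(1−βλ')V + zλλ'VV'` gives
`V_P = (2(β−1)v + z v²)/(2β−1)`. -/
theorem fixedPoint_VP {β z v VP : ℝ} (hg : 2 * β - 1 ≠ 0)
    (hP : VP * (1 / (2 * β - 1) + 1 / (2 * β - 1) - (2 * β - 1) * (1 / (2 * β - 1)) * (1 / (2 * β - 1))) =
      1 / (2 * β - 1) * (1 - β * (1 / (2 * β - 1))) * v + 1 / (2 * β - 1) * (1 - β * (1 / (2 * β - 1))) * v +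
        z * (1 / (2 * β - 1)) * (1 / (2 * β - 1)) * v * v) :
    VP = (2 * (β - 1) * v + z * v ^ 2) / (2 * β - 1) := by
  set g := 2 * β - 1 with hgdef
  have hβ : β = (g + 1) / 2 := by rw [hgdef]; ring
  rw [hβ] at hP ⊢
  field_simp at hP
  field_simp
  nlinarith [hP]

/-- **Squaring contracts narrowness at the deep fixed point**: `V_P < v` when `0 < v`, `z·v < 1`,
`1/2 < β` (the contraction factor is `(2(β−1) + z v)/(2β−1) < 1`). -/
theorem fixedPoint_VP_lt {β z v : ℝ} (hβ : 1 / 2 < β) (hv : 0 < v) (hzv : z * v < 1) :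
    (2 * (β - 1) * v + z * v ^ 2) / (2 * β - 1) < v := by
  have hg : 0 < 2 * β - 1 := by linarith
  rw [div_lt_iff₀ hg]
  nlinarith [mul_pos hv (by linarith : (0 : ℝ) < 1 - z * v)]

/-- The contraction in closed form: `v − V_P = v(1 − z v)/(2β−1)`. -/
theorem fixedPoint_VP_defect {β z v : ℝ} (hg : 2 * β - 1 ≠ 0) :
    v - (2 * (β - 1) * v + z * v ^ 2) / (2 * β - 1) = v * (1 - z * v) / (2 * β - 1) := by
  field_simp
  ring

/-- **Pairs at the floor are excluded.** If both factors sit at a positive floor `v = Vmin > 0` with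
`z·Vmin < 1`, the product violates `Vmin ≤ V_P`. -/
theorem fixedPoint_floorPair_excluded {β z Vmin : ℝ} (hβ : 1 / 2 < β) (hV : 0 < Vmin)
    (hzV : z * Vmin < 1) : ¬ Vmin ≤ (2 * (β - 1) * Vmin + z * Vmin ^ 2) / (2 * β - 1) :=
  not_le.mpr (fixedPoint_VP_lt hβ hV hzV)

/-! ## The budget -/

/-- **THE FIXED-POINT BUDGET (identity).** At `λ = λ' = 1/(2β−1)`, `V = V' = v`, `x = 1/2`, exponent
`κ_S`, with `V_P = (2(β−1)v + z v²)/(2β−1)`: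
`RHS − LHS = (v(2 − β/2) − z v² − (ε+1)(2−β)/2)/(2β−1)²`. -/
theorem fixedPoint_budget {β ε z v : ℝ} (hg : 2 * β - 1 ≠ 0) :
    (1 / (2 * β - 1) + 1 / (2 * β - 1) - (2 * β - 1) * (1 / (2 * β - 1)) * (1 / (2 * β - 1))) *
        (ε + 1 - (2 * (β - 1) * v + z * v ^ 2) / (2 * β - 1)) -
      ((1 - (β - 1) * (1 / (2 * β - 1))) * (1 / (2 * β - 1) * (ε + 1 - v)) *
          (1 / 2 : ℝ) ^ (Real.log (4 / 3) / Real.log 2) +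
        (1 - (β - 1) * (1 / (2 * β - 1))) * (1 / (2 * β - 1) * (ε + 1 - v)) *
          (1 - 1 / 2 : ℝ) ^ (Real.log (4 / 3) / Real.log 2)) =
      (v * (2 - β / 2) - z * v ^ 2 - (ε + 1) * (2 - β) / 2) / (2 * β - 1) ^ 2 := by
  have hhalf : (1 - 1 / 2 : ℝ) = 1 / 2 := by norm_num
  rw [hhalf, half_rpow_kappaS]
  field_simp
  ring

/-- **The pair inequality at the deep fixed point, decided**: it holds (`LHS ≤ RHS`) iff
`(ε+1)(2−β)/2 + z v² ≤ (2 − β/2)·v` (`β > 1/2`). -/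
theorem fixedPoint_pair_iff {β ε z v : ℝ} (hβ : 1 / 2 < β) :
    (1 - (β - 1) * (1 / (2 * β - 1))) * (1 / (2 * β - 1) * (ε + 1 - v)) *
          (1 / 2 : ℝ) ^ (Real.log (4 / 3) / Real.log 2) +
        (1 - (β - 1) * (1 / (2 * β - 1))) * (1 / (2 * β - 1) * (ε + 1 - v)) *
          (1 - 1 / 2 : ℝ) ^ (Real.log (4 / 3) / Real.log 2) ≤
      (1 / (2 * β - 1) + 1 / (2 * β - 1) - (2 * β - 1) * (1 / (2 * β - 1)) * (1 / (2 * β - 1))) *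
        (ε + 1 - (2 * (β - 1) * v + z * v ^ 2) / (2 * β - 1)) ↔
    (ε + 1) * (2 - β) / 2 + z * v ^ 2 ≤ (2 - β / 2) * v := by
  have hg : (2 * β - 1) ≠ 0 := by intro h; linarith
  have hg2 : 0 < (2 * β - 1) ^ 2 := by positivity
  have key := fixedPoint_budget (ε := ε) (z := z) (v := v) hg
  rw [← sub_nonneg, key, div_nonneg_iff]
  constructor
  · rintro (⟨h, _⟩ | ⟨_, h⟩)
    · linarith
    · linarith
  · intro h
    exact Or.inl ⟨by linarith, hg2.le⟩

/-- **A pair sitting at narrowness of the floor's asymptotic size `(2−β)/2`** (XLIII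
`Vfloor_le_one_sub_half`): there the first-order terms CANCEL and the fixed-point pair inequality is
decided at second order — it holds iff `2ε ≤ (1−z)(2−β)` (`β < 2`).  So at floor-sized narrowness the
budget is marginal (and fails for any fixed `ε > 0` as `β → 2`); the margin of the surviving pairs
comes from `v ≥ v_min > Vfloor`, i.e. from the exclusion `Vmin ≤ V_P`, not from the floor value. -/
theorem fixedPoint_at_half_gap_iff {β ε z : ℝ} (hβ2 : β < 2) :
    (ε + 1) * (2 - β) / 2 + z * ((2 - β) / 2) ^ 2 ≤ (2 - β / 2) * ((2 - β) / 2) ↔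
      2 * ε ≤ (1 - z) * (2 - β) := by
  have hd : 0 < 2 - β := by linarith
  have key : (2 - β / 2) * ((2 - β) / 2) - ((ε + 1) * (2 - β) / 2 + z * ((2 - β) / 2) ^ 2) =
      (2 - β) * ((1 - z) * (2 - β) - 2 * ε) / 4 := by ring
  rw [← sub_nonneg, key]
  constructor
  · intro h
    by_contra hX
    have hneg : (2 - β) * ((1 - z) * (2 - β) - 2 * ε) < 0 :=
      mul_neg_of_pos_of_neg hd (by linarith [not_le.mp hX])
    linarith
  · intro hX
    have := mul_nonneg hd.le (by linarith [hX] : (0 : ℝ) ≤ (1 - z) * (2 - β) - 2 * ε)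
    linarith

/-- **But narrowness `v ≥ (2−β)·(1+ε)/(2−β/2−zv)`-sized pays it**: a clean sufficient condition —
if `(ε+1)(2−β) ≤ v` and `z v ≤ 1 − β/4` (e.g. `v ≤ 1/2`, `z ≤ 1`, `β ≤ 2`) and `0 ≤ v`, the
fixed-point pair inequality holds.  (Near `β = 2` the surviving pairs have `v ≳ (3/2)·Vfloor ≈
(3/4)(2−β)`, short of `(1+ε)(2−β)`; the actual margin there is the finer bookkeeping of the memo —
this lemma only records that narrowness of the ORDER `2 − β` is what the budget needs.) -/
theorem fixedPoint_pair_of_linear_narrowness {β ε z v : ℝ} (hβ2 : β ≤ 2) (hv : 0 ≤ v)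
    (hbig : (ε + 1) * (2 - β) ≤ v) (hzv : z * v ≤ 1 - β / 4) :
    (ε + 1) * (2 - β) / 2 + z * v ^ 2 ≤ (2 - β / 2) * v := by
  have h1 : z * v ^ 2 ≤ (1 - β / 4) * v := by nlinarith [mul_le_mul_of_nonneg_left hzv hv]
  have h2 : 0 ≤ (2 - β) * v := mul_nonneg (by linarith) hv
  nlinarith [h1, h2]

end Summit.MatrixMultiplication.MatrixMultiplication.Theorems.FarEdgeDescentFixedPointBudget
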